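import Mathlib
import HarnessLib
import Summits.ValiantsHypothesis.ValiantsHypothesis.Theses.MonotoneRestoration
import Literature.Computability.AlgebraicComplexity.ArithCircuit
import Literature.Computability.AlgebraicComplexity.ArithCircuitProofs
import Literature.Computability.AlgebraicComplexity.MonotoneStructure
import Literature.Computability.AlgebraicComplexity.PermanentIrreducible
import Literature.ModelTheory.FiniteModelTheory.CkEquiv
import Summits.ValiantsHypothesis.ValiantsHypothesis.Theorems.MonotoneRestorationMonotoneRestorationQPCosetCount
import Summits.ValiantsHypothesis.ValiantsHypothesis.Theorems.MonotoneRestorationMonotoneRestorationQPSymmetricLB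
import Summits.ValiantsHypothesis.ValiantsHypothesis.Theorems.MonotoneRestorationMonotoneRestorationQPSupportSymmetrisation
import Summits.ValiantsHypothesis.ValiantsHypothesis.Theorems.MonotoneRestorationMonotoneRestorationQPSparseRegime
import Summits.ValiantsHypothesis.ValiantsHypothesis.Theorems.MonotoneRestorationMonotoneRestorationQPBeta
import Literature.Computability.AlgebraicComplexity.SymmetricArithCircuit
import Literature.Computability.AlgebraicComplexity.DawarWilsenach2025Proofs
import Literature.GroupTheory.PermutationGroups.SmallIndexSubgroups
import Summits.ValiantsHypothesis.ValiantsHypothesis.Theorems.MonotoneRestorationQP.Negative.LoadBearing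
import Summits.ValiantsHypothesis.ValiantsHypothesis.Theorems.MonotoneRestorationMonotoneRestorationQPPermSupportCount

/-! TTRL-lite variant V20175 of stmt-ValiantsHypothesis-15886 -/

-- `Summit.ValiantsHypothesis.ValiantsHypothesis.…` is the tree's mandated single-conjunct layout
-- (Sub = Summit), so the duplicated namespace component is intended.
set_option linter.dupNamespace false

namespace Summit.ValiantsHypothesis.ValiantsHypothesis.Theorems

open Summit.ValiantsHypothesis.ValiantsHypothesis.Theses.MonotoneRestoration
open Literature.Computability.AlgebraicComplexity

/-- **TTRL-lite variant V20175 of `stub_esymmRowSums_structure` (stmt-ValiantsHypothesis-15886).**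
Intermediate form of the row/column-permutation invariance of `e_k` of the row sums
`R_i = Σ_j x_{i,j}`: renaming the variables by `(i, j) ↦ (σ i, τ j)` turns `e_k(R_0, …, R_{n-1})`
into `e_k(R_{σ 0}, …, R_{σ (n-1)})` (the column permutation `τ` is absorbed by reindexing each
row sum). Proof: `rename_bind₁`, then `rename (σ × τ) (Σ_j X (i, j)) = Σ_j X (σ i, τ j) = Σ_j X (σ i, j)`
by `Equiv.sum_comp τ`. [folklore] -/
theorem stub_esymmRowSums_structure_var20175 :
    ∀ (n k : ℕ) (σ τ : Equiv.Perm (Fin n)),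
      MvPolynomial.rename (fun p : Fin n × Fin n => (σ p.1, τ p.2))
        (MvPolynomial.bind₁ (fun i : Fin n => ∑ j : Fin n, MvPolynomial.X (i, j))
          (MvPolynomial.esymm (Fin n) NNReal k)) =
      MvPolynomial.bind₁ (fun i : Fin n => ∑ j : Fin n,
          (MvPolynomial.X (σ i, j) : MvPolynomial (Fin n × Fin n) NNReal))
        (MvPolynomial.esymm (Fin n) NNReal k) := by
  intro n k σ τ
  rw [MvPolynomial.rename_bind₁]
  have h : (fun i : Fin n => MvPolynomial.rename (fun p : Fin n × Fin n => (σ p.1, τ p.2))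
      (∑ j : Fin n, (MvPolynomial.X (i, j) : MvPolynomial (Fin n × Fin n) NNReal))) =
      fun i : Fin n => ∑ j : Fin n,
        (MvPolynomial.X (σ i, j) : MvPolynomial (Fin n × Fin n) NNReal) := by
    funext i
    simp only [map_sum, MvPolynomial.rename_X]
    exact Equiv.sum_comp τ
      (fun j => (MvPolynomial.X (σ i, j) : MvPolynomial (Fin n × Fin n) NNReal))
  rw [h]

end Summit.ValiantsHypothesis.ValiantsHypothesis.Theorems
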